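import Literature.AlgebraicGeometry.Resolution.KummerChart
import Mathlib.LinearAlgebra.Dimension.StrongRankCondition
import Mathlib.LinearAlgebra.FreeModule.PID
import Mathlib.Algebra.Order.Monoid.Submonoid
import HarnessLib

/-!
# Faces of the Kummer cone at the non-closed primes, and the orthant chart

Topic: `Literature/AlgebraicGeometry/Resolution`. Combinatorics of the Kummer chart
`P = kummerCone p j₀ c → T` (`KummerCone.lean`, `KummerChart.lean`; the fs monoid of the
normalised Kummer cover `τ^p = x^c` along an snc boundary `x_1 ⋯ x_r`) needed for Kato's
condition (2.1) at an ARBITRARY prime of the chart ring, where only the boundary equations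
`x_j`, `j ∈ J`, vanish (K. Kato, *Toric singularities*, Amer. J. Math. 116 (1994), Def. (2.1)):

* `kummerExp_residue` — the residues mod `p` of the honest exponent `e = kummerExp v` are
  `e_j ≡ A_j · (c₀ v_{j₀})` when `c = c₀ A mod p`, `c₀ A_{j₀} ≡ 1`;
* `exists_kummerExp_eq_of_residue` — conversely every `E ∈ ℤʳ` with residues `E_j ≡ A_j δ` is
  an honest exponent `kummerExp v`; hence (`exists_mem_kummerCone_extend`) every element of the
  cone of the RE-CENTRED chart at such a prime (coordinates `J`, new pivot `j₁ ∈ J` with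
  `p ∤ A_{j₁}`) is hit, on the coordinates `J`, by an element of `P` whose remaining exponents
  are the prescribed `A_j c₁ e'_{j₁}`;
* `finrank_span_face_kummerCone` — the face `{v ∈ P | e_j(v) = 0 ∀ j ∈ J}` of chart elements
  invertible at the prime spans a lattice of rank `r - #J`;
* `toricChart_pow` — `chart(v)^p = x^{e(v)}` in the toric algebra;
* the orthant `ℕʳ = AddSubmonoid.nonneg (Fin r → ℤ)` (chart of a wound/transversal centre):
  `nonneg_fg`, `nonneg_saturated`, `span_nonneg_eq_top`, `finrank_span_face_nonneg`.

Sources: [Kato1994] K. Kato, Amer. J. Math. 116 (1994), (1.5), Def. (2.1), (2.2)(2).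
-/

noncomputable section

namespace Literature.AlgebraicGeometry.Resolution

open Module

variable {r : ℕ}

/-! ## Residues of Kummer exponents -/

/-- `c₀ A_{j₀} ≡ 1 (mod p)` in `ZMod p`. [folklore] -/
theorem cast_mul_eq_one_of_mod {p : ℕ} {c₀ a : ℕ} (h : c₀ * a % p = 1) :
    ((c₀ : ZMod p) * (a : ZMod p)) = 1 := by
  rw [← Nat.cast_mul, ← ZMod.natCast_mod, h, Nat.cast_one]

/-- **Residues of the honest exponent**: for `c_j = c₀ A_j mod p` with `c₀ A_{j₀} ≡ 1`,
`(kummerExp v)_j ≡ A_j · c₀ v_{j₀} (mod p)` for every `j`. [folklore] -/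
theorem kummerExp_residue {p : ℕ} (j₀ : Fin r) (A : Fin r → ℕ) (c₀ : ℕ)
    (hc₀ : c₀ * A j₀ % p = 1) (v : Fin r → ℤ) (j : Fin r) :
    ((kummerExp p j₀ (fun j => c₀ * A j % p) v j : ℤ) : ZMod p) =
      (A j : ZMod p) * ((c₀ : ZMod p) * (v j₀ : ZMod p)) := by
  by_cases hj : j = j₀
  · subst hj
    rw [kummerExp_apply_self, ← mul_assoc, mul_comm (A j : ZMod p), cast_mul_eq_one_of_mod hc₀,
      one_mul]
  · rw [kummerExp_apply_of_ne p _ v hj]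
    push_cast
    rw [ZMod.natCast_self]
    ring

/-- **Every exponent vector with residues `A_j δ` is an honest Kummer exponent.** [folklore] -/
theorem exists_kummerExp_eq_of_residue {p : ℕ} (j₀ : Fin r) (A : Fin r → ℕ)
    (c₀ : ℕ) (hc₀ : c₀ * A j₀ % p = 1) (E : Fin r → ℤ) (δ : ZMod p)
    (hE : ∀ j, ((E j : ℤ) : ZMod p) = (A j : ZMod p) * δ) :
    ∃ v : Fin r → ℤ, kummerExp p j₀ (fun j => c₀ * A j % p) v = E := by
  refine ⟨fun j => if j = j₀ then E j₀ else (E j - (c₀ * A j % p : ℕ) * E j₀) / p, ?_⟩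
  ext j
  by_cases hj : j = j₀
  · subst hj; simp [kummerExp]
  · rw [kummerExp_apply_of_ne p _ _ hj]
    simp only [hj, if_false, if_true]
    have hdvd : (p : ℤ) ∣ E j - (c₀ * A j % p : ℕ) * E j₀ := by
      rw [← ZMod.intCast_zmod_eq_zero_iff_dvd]
      push_cast
      rw [hE j, hE j₀]
      have h1 := cast_mul_eq_one_of_mod hc₀
      linear_combination (-((A j : ZMod p) * δ)) * h1
    rw [Int.mul_ediv_cancel' hdvd]
    ring

/-- **Re-centring the chart at a prime.** Let `σ : Fin s → Fin r` enumerate injectively the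
boundary coordinates through the prime, `j₁ = σ i₁` a pivot there (`c₁ A_{j₁} ≡ 1 (mod p)`).
Every element `w` of the re-centred cone `kummerCone p i₁ (c₁ A∘σ mod p)` is matched by an
element `v` of the original cone: same honest exponents on the coordinates `σ i`, and exponent
`A_j c₁ e'(w)_{i₁}` at the other coordinates. [cite: Kato1994, Def. (2.1)] -/
theorem exists_mem_kummerCone_extend {p : ℕ} (j₀ : Fin r) (A : Fin r → ℕ)
    (c₀ : ℕ) (hc₀ : c₀ * A j₀ % p = 1) {s : ℕ} (σ : Fin s → Fin r) (hσ : Function.Injective σ)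
    (i₁ : Fin s) (c₁ : ℕ) (hc₁ : c₁ * A (σ i₁) % p = 1)
    (w : Fin s → ℤ) (hw : w ∈ kummerCone p i₁ (fun i => c₁ * A (σ i) % p)) :
    ∃ v ∈ kummerCone p j₀ (fun j => c₀ * A j % p),
      (∀ i, kummerExp p j₀ (fun j => c₀ * A j % p) v (σ i) =
        kummerExp p i₁ (fun i => c₁ * A (σ i) % p) w i) ∧
      (∀ j, (∀ i, σ i ≠ j) → kummerExp p j₀ (fun j => c₀ * A j % p) v j =
        A j * c₁ * kummerExp p i₁ (fun i => c₁ * A (σ i) % p) w i₁) := by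
  classical
  set e' := kummerExp p i₁ (fun i => c₁ * A (σ i) % p) w with he'
  -- the target exponent vector
  let E : Fin r → ℤ := fun j =>
    if h : ∃ i, σ i = j then e' h.choose else A j * c₁ * e' i₁
  have hEσ : ∀ i, E (σ i) = e' i := by
    intro i
    have h : ∃ i', σ i' = σ i := ⟨i, rfl⟩
    simp only [E, dif_pos h]
    rw [hσ h.choose_spec]
  have hEout : ∀ j, (∀ i, σ i ≠ j) → E j = A j * c₁ * e' i₁ := by
    intro j hj
    have h : ¬ ∃ i, σ i = j := fun ⟨i, hi⟩ => hj i hi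
    simp only [E, dif_neg h]
  -- its residues are `A_j δ` with `δ = c₁ w_{i₁}`
  have hres : ∀ j, ((E j : ℤ) : ZMod p) = (A j : ZMod p) * ((c₁ : ZMod p) * (w i₁ : ZMod p)) := by
    intro j
    by_cases h : ∃ i, σ i = j
    · obtain ⟨i, rfl⟩ := h
      rw [hEσ, he']
      exact kummerExp_residue i₁ (fun i => A (σ i)) c₁ hc₁ w i
    · have hj : ∀ i, σ i ≠ j := fun i hi => h ⟨i, hi⟩
      rw [hEout j hj, he', kummerExp_apply_self]
      push_cast
      ring
  obtain ⟨v, hv⟩ := exists_kummerExp_eq_of_residue j₀ A c₀ hc₀ E _ hres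
  refine ⟨v, ?_, fun i => by rw [hv, hEσ], fun j hj => by rw [hv, hEout j hj]⟩
  -- non-negativity
  intro j
  rw [hv]
  by_cases h : ∃ i, σ i = j
  · obtain ⟨i, rfl⟩ := h
    rw [hEσ]
    exact hw i
  · rw [hEout j fun i hi => h ⟨i, hi⟩]
    have := hw i₁
    positivity

/-! ## The face of the cone at a prime -/

/-- `kummerExp (n e_j) = p n e_j` for `j ≠ j₀`. [folklore] -/
theorem kummerExp_single_of_ne (p : ℕ) {j₀ j : Fin r} (c : Fin r → ℕ) (hj : j ≠ j₀) (n : ℤ) :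
    kummerExp p j₀ c (Pi.single j n) = Pi.single j ((p : ℤ) * n) := by
  ext k
  by_cases hk : k = j₀
  · subst hk
    rw [kummerExp_apply_self, Pi.single_eq_of_ne (Ne.symm hj), Pi.single_eq_of_ne (Ne.symm hj)]
  · rw [kummerExp_apply_of_ne p c _ hk, Pi.single_eq_of_ne (Ne.symm hj), mul_zero, zero_add,
      Pi.single_apply, Pi.single_apply]
    split_ifs <;> simp

/-- The sublattice of vectors vanishing on the coordinates `J` is free of rank `r - #J`.
[folklore] -/
theorem finrank_pi_bot (J : Finset (Fin r)) :
    finrank ℤ (Submodule.pi (J : Set (Fin r)) (fun _ => (⊥ : Submodule ℤ ℤ))) + J.card = r := by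
  classical
  let V := Submodule.pi (J : Set (Fin r)) (fun _ => (⊥ : Submodule ℤ ℤ))
  let e : V ≃ₗ[ℤ] ({j // j ∉ J} → ℤ) :=
    { toFun := fun v j => (v : Fin r → ℤ) j
      map_add' := fun _ _ => rfl
      map_smul' := fun _ _ => rfl
      invFun := fun g => ⟨fun j => if h : j ∈ J then 0 else g ⟨j, h⟩, fun j hj => by
        simp [Finset.mem_coe.mp hj]⟩
      left_inv := fun v => by
        ext j
        by_cases h : j ∈ J
        · have := (Submodule.mem_pi.mp v.2) j (Finset.mem_coe.mpr h)
          rw [Submodule.mem_bot] at this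
          simp [h, this]
        · simp [h]
      right_inv := fun g => by
        ext ⟨j, hj⟩
        simp [hj] }
  change finrank ℤ V + J.card = r
  rw [e.finrank_eq, finrank_fintype_fun_eq_card, Fintype.card_subtype_compl,
    Fintype.card_coe, Fintype.card_fin, Nat.sub_add_cancel (J.card_le_univ.trans_eq (by simp))]

/-- Scaling the unit vectors by a non-zero integer keeps them linearly independent.
[folklore] -/
theorem linearIndependent_smul_single {p : ℤ} (hp : p ≠ 0) (J : Finset (Fin r)) :
    LinearIndependent ℤ (fun j : {j // j ∉ J} => p • (Pi.single (j : Fin r) (1 : ℤ) : Fin r → ℤ)) := by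
  have hsingle : LinearIndependent ℤ
      (fun j : {j // j ∉ J} => (Pi.single (j : Fin r) (1 : ℤ) : Fin r → ℤ)) :=
    (Pi.linearIndependent_single_one (Fin r) ℤ).comp _ Subtype.val_injective
  rw [linearIndependent_iff'] at hsingle ⊢
  intro s g hg i hi
  apply hsingle s g _ i hi
  have h1 : p • ∑ i ∈ s, g i • (Pi.single (i : Fin r) (1 : ℤ) : Fin r → ℤ) = 0 := by
    rw [Finset.smul_sum]
    rw [← hg]
    exact Finset.sum_congr rfl fun i _ => smul_comm _ _ _
  exact smul_right_injective (Fin r → ℤ) hp (h1.trans (smul_zero p).symm)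

/-- **The face of chart elements invertible at a prime through the coordinates `J` spans a
lattice of rank `r - #J`**: `rank span{v ∈ P | (kummerExp v)_j = 0 ∀ j ∈ J} + #J = r`
(upper bound: `kummerExp` embeds the span into the vectors vanishing on `J`; lower bound: the
`r - #J` elements `e_j` (`j ∉ J`, `j ≠ j₀`) and `(p; -c)` (if `j₀ ∉ J`) of the face have
independent images `p e_j`). [cite: Kato1994, Def. (2.1)] -/
theorem finrank_span_face_kummerCone {p : ℕ} (hp : 0 < p) (j₀ : Fin r) (c : Fin r → ℕ)
    (J : Finset (Fin r)) :
    finrank ℤ (Submodule.span ℤ ((fun v : kummerCone p j₀ c => (v : Fin r → ℤ)) ''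
      {v | ∀ j ∈ J, kummerExp p j₀ c v j = 0})) + J.card = r := by
  classical
  let f : (Fin r → ℤ) →ₗ[ℤ] (Fin r → ℤ) :=
    { toFun := kummerExp p j₀ c
      map_add' := map_add _
      map_smul' := fun m v => by
        rw [map_zsmul, RingHom.id_apply] }
  have hf : ∀ v, f v = kummerExp p j₀ c v := fun v => rfl
  have hfinj : Function.Injective f := kummerExp_injective hp j₀ c
  set F : Set (kummerCone p j₀ c) := {v | ∀ j ∈ J, kummerExp p j₀ c v j = 0} with hFdef
  set S := Submodule.span ℤ ((fun v : kummerCone p j₀ c => (v : Fin r → ℤ)) '' F) with hSdef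
  set V := Submodule.pi (J : Set (Fin r)) (fun _ => (⊥ : Submodule ℤ ℤ)) with hVdef
  have hV : finrank ℤ V + J.card = r := finrank_pi_bot J
  -- upper bound
  have hSV : S.map f ≤ V := by
    rw [hSdef, Submodule.map_span, Submodule.span_le]
    rintro _ ⟨_, ⟨v, hv, rfl⟩, rfl⟩
    exact Submodule.mem_pi.mpr fun j hj => (Submodule.mem_bot ℤ).mpr (hv j (Finset.mem_coe.mp hj))
  let g : S →ₗ[ℤ] V := (f.domRestrict S).codRestrict V fun v => hSV ⟨v, v.2, rfl⟩
  have hg : Function.Injective g := by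
    intro v w hvw
    apply Subtype.ext
    apply hfinj
    have := congrArg Subtype.val hvw
    exact this
  have hup : finrank ℤ S ≤ finrank ℤ V := LinearMap.finrank_le_finrank_of_injective hg
  -- lower bound
  let B : {j // j ∉ J} → (Fin r → ℤ) := fun j =>
    if (j : Fin r) = j₀ then pivotGen p j₀ c else Pi.single (j : Fin r) 1
  have hBmem : ∀ j, B j ∈ kummerCone p j₀ c := fun j => by
    simp only [B]
    split_ifs with h
    · exact pivotGen_mem_kummerCone p j₀ c
    · exact_mod_cast single_mem_kummerCone p j₀ c j 1
  have hfB : ∀ j, f (B j) = (p : ℤ) • (Pi.single (j : Fin r) (1 : ℤ) : Fin r → ℤ) := by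
    intro j
    rw [hf]
    simp only [B]
    split_ifs with h
    · rw [kummerExp_pivotGen, ← h]
      ext k
      rw [Pi.smul_apply, Pi.single_apply, Pi.single_apply]
      split_ifs <;> simp
    · rw [kummerExp_single_of_ne p c h]
      ext k
      rw [Pi.smul_apply, Pi.single_apply, Pi.single_apply]
      split_ifs <;> simp
  have hBF : ∀ j, B j ∈ S := fun j => by
    refine Submodule.subset_span ⟨⟨B j, hBmem j⟩, fun k hk => ?_, rfl⟩
    have := congrFun (hfB j) k
    rw [hf] at this
    rw [this]
    have hkj : k ≠ (j : Fin r) := fun h => j.2 (h ▸ hk)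
    simp [hkj]
  have hBli : LinearIndependent ℤ B := by
    refine LinearIndependent.of_comp f ?_
    have : f ∘ B = fun j : {j // j ∉ J} => (p : ℤ) • (Pi.single (j : Fin r) (1 : ℤ) : Fin r → ℤ) :=
      funext hfB
    rw [this]
    exact linearIndependent_smul_single (by exact_mod_cast hp.ne') J
  let b : {j // j ∉ J} → S := fun j => ⟨B j, hBF j⟩
  have hbli : LinearIndependent ℤ b :=
    LinearIndependent.of_comp S.subtype (hBli : LinearIndependent ℤ (S.subtype ∘ b))
  have hlow : Fintype.card {j // j ∉ J} ≤ finrank ℤ S := hbli.fintype_card_le_finrank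
  rw [Fintype.card_subtype_compl, Fintype.card_coe, Fintype.card_fin] at hlow
  have hJ : J.card ≤ r := J.card_le_univ.trans_eq (by simp)
  omega

/-! ## The `p`-th power of a chart value -/

namespace RootCover

variable {O : Type*} [CommRing O] {p : ℕ} [hp : Fact p.Prime] {x : Fin r → O}
  {j₀ : Fin r} {c : Fin r → ℕ}

omit hp in
/-- `rootMonomial(e)^p = x^e`. [folklore] -/
theorem rootMonomial_pow_p (e : Fin r → ℕ) :
    rootMonomial p x e ^ p = algebraMap O (RootCover p x) (∏ j, x j ^ e j) := by
  rw [rootMonomial, ← Finset.prod_pow, map_prod]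
  refine Finset.prod_congr rfl fun j _ => ?_
  rw [← pow_mul, mul_comm, pow_mul, root_pow, map_pow]

/-- **`chart(v)^p = x^{e(v)}`** in the toric algebra, `e = kummerExp v` the honest exponent.
[cite: Kato1994, (2.2)(2)] -/
theorem toricChart_pow_p (hc : c j₀ = 1) (v : Multiplicative (kummerCone p j₀ c)) :
    toricChart p x j₀ c hc v ^ p =
      algebraMap O (toric p x j₀ c) (∏ j, x j ^ natExp p j₀ c v.toAdd j) := by
  apply Subtype.ext
  rw [SubmonoidClass.coe_pow, coe_toricChart, chart_apply, rootMonomial_pow_p]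
  rfl

end RootCover

/-! ## The orthant `ℕʳ ⊆ ℤʳ` (chart of a wound / transversal centre) -/

/-- Membership in the orthant, coordinatewise. [folklore] -/
theorem mem_nonneg_pi_iff {v : Fin r → ℤ} : v ∈ AddSubmonoid.nonneg (Fin r → ℤ) ↔ ∀ j, 0 ≤ v j :=
  Iff.rfl

/-- The orthant is generated by the unit vectors. [folklore] -/
theorem nonneg_eq_closure_single :
    AddSubmonoid.nonneg (Fin r → ℤ) = AddSubmonoid.closure (Set.range fun j : Fin r => Pi.single j (1 : ℤ)) := by
  apply le_antisymm
  · intro v hv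
    exact mem_closure_single_of_nonneg hv
  · rw [AddSubmonoid.closure_le]
    rintro _ ⟨j, rfl⟩ k
    by_cases h : k = j
    · subst h; simp
    · simp [h]

/-- The orthant is finitely generated. [cite: Kato1994, (1.5)] -/
theorem nonneg_fg : (AddSubmonoid.nonneg (Fin r → ℤ)).FG :=
  ⟨Finset.univ.image fun j : Fin r => Pi.single j (1 : ℤ), by
    rw [nonneg_eq_closure_single, Finset.coe_image, Finset.coe_univ, Set.image_univ]⟩

/-- The orthant is saturated in `ℤʳ`. [cite: Kato1994, (1.1)] -/
theorem nonneg_saturated (v : Fin r → ℤ) (k : ℕ) (hk : 0 < k)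
    (hv : k • v ∈ AddSubmonoid.nonneg (Fin r → ℤ)) : v ∈ AddSubmonoid.nonneg (Fin r → ℤ) := by
  intro j
  have h : (0 : ℤ) ≤ (k : ℤ) * v j := by
    have := hv j
    simpa [nsmul_eq_mul] using this
  have hk' : (0 : ℤ) < k := by exact_mod_cast hk
  change (0 : ℤ) ≤ v j
  nlinarith

/-- The orthant spans `ℤʳ`. [cite: Kato1994, (1.5)] -/
theorem span_nonneg_eq_top :
    Submodule.span ℤ (AddSubmonoid.nonneg (Fin r → ℤ) : Set (Fin r → ℤ)) = ⊤ := by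
  refine top_le_iff.mp fun v _ => ?_
  rw [← posPart_sub_negPart v]
  exact Submodule.sub_mem _ (Submodule.subset_span fun j => posPart_nonneg v j)
    (Submodule.subset_span fun j => negPart_nonneg v j)

/-- **The face of the orthant at a prime through the coordinates `J`** spans a lattice of rank
`r - #J`. [cite: Kato1994, Def. (2.1)] -/
theorem finrank_span_face_nonneg (J : Finset (Fin r)) :
    finrank ℤ (Submodule.span ℤ ((fun v : AddSubmonoid.nonneg (Fin r → ℤ) => (v : Fin r → ℤ)) ''
      {v | ∀ j ∈ J, (v : Fin r → ℤ) j = 0})) + J.card = r := by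
  classical
  set F : Set (AddSubmonoid.nonneg (Fin r → ℤ)) := {v | ∀ j ∈ J, (v : Fin r → ℤ) j = 0} with hFdef
  set S := Submodule.span ℤ ((fun v : AddSubmonoid.nonneg (Fin r → ℤ) => (v : Fin r → ℤ)) '' F)
    with hSdef
  set V := Submodule.pi (J : Set (Fin r)) (fun _ => (⊥ : Submodule ℤ ℤ)) with hVdef
  have hV : finrank ℤ V + J.card = r := finrank_pi_bot J
  have hSV : S ≤ V := by
    rw [hSdef, Submodule.span_le]
    rintro _ ⟨v, hv, rfl⟩
    exact Submodule.mem_pi.mpr fun j hj => (Submodule.mem_bot ℤ).mpr (hv j (Finset.mem_coe.mp hj))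
  have hup : finrank ℤ S ≤ finrank ℤ V := Submodule.finrank_mono hSV
  let B : {j // j ∉ J} → (Fin r → ℤ) := fun j => Pi.single (j : Fin r) 1
  have hBF : ∀ j, B j ∈ S := fun j => by
    refine Submodule.subset_span ⟨⟨B j, fun k => ?_⟩, fun k hk => ?_, rfl⟩
    · by_cases h : k = j
      · subst h; simp [B]
      · simp [B, h]
    · have hkj : k ≠ (j : Fin r) := fun h => j.2 (h ▸ hk)
      simp [B, hkj]
  have hBli : LinearIndependent ℤ B := by
    have := linearIndependent_smul_single (r := r) one_ne_zero J
    simpa [B] using this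
  let b : {j // j ∉ J} → S := fun j => ⟨B j, hBF j⟩
  have hbli : LinearIndependent ℤ b :=
    LinearIndependent.of_comp S.subtype (hBli : LinearIndependent ℤ (S.subtype ∘ b))
  have hlow : Fintype.card {j // j ∉ J} ≤ finrank ℤ S := hbli.fintype_card_le_finrank
  rw [Fintype.card_subtype_compl, Fintype.card_coe, Fintype.card_fin] at hlow
  have hJ : J.card ≤ r := J.card_le_univ.trans_eq (by simp)
  omega

end Literature.AlgebraicGeometry.Resolution

end
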